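import Literature.NumberTheory.Transcendental.KZHomotopyMoves
import Literature.NumberTheory.Transcendental.SemialgebraicLineDeriv
import Summits.KontsevichZagierPeriods.KontsevichZagierPeriods.Statement
import HarnessLib

/-!
# SoloInformed — cells and auxiliary moves for Green's formula on the triangle

Support file for `SoloInformedKZStokesOne.lean` (Green's formula on the standard triangle as a
combination of the four Kontsevich–Zagier moves of `KZCalculus.lean`). Contents:

* the cells `soloInformedUnitI = [0,1] ⊆ ℝ¹`, `soloInformedTriangle = Δ ⊆ ℝ²` (semialgebraic,
  compact; `Δ` is the band over `[0,1]` with fibres `[0, 1 − x]`, the domain shape of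
  `KZ.newtonLeibnizRel`), and the coordinate swap of `ℝ²`;
* the representation constructors `soloInformedTriRep`, `soloInformedIRep` (continuous semialgebraic
  integrands on the two cells);
* two change-of-variables moves with `|det| = 1`: the swap of the triangle
  (`soloInformed_of_sub_of_swap_mem_relations`) and the reflection `t ↦ 1 − t` of `[0,1]`
  (`soloInformed_of_sub_of_reflect_mem_relations`);
* calculus along the fibres (`Fin.snoc`) and the edge-restriction lemma `soloInformed_edge_comp`.

Residency `solo-KontsevichZagierPeriods-informed` (PLAN.md THEOREM D, dictionary §3, case `m = 1`).
References: M. Kontsevich, D. Zagier, *Periods* (2001), §1.2; J. Bochnak, M. Coste, M.-F. Roy,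
*Real Algebraic Geometry* (1998), §2.1.
-/

noncomputable section

open MeasureTheory Set Filter
open scoped Topology

namespace Summit.KontsevichZagierPeriods.KontsevichZagierPeriods.Theorems

open Literature.NumberTheory.Transcendental Literature.NumberTheory.Transcendental.KZ
open Literature.ModelTheory.ExponentialFields (IsSemialgebraic isSemialgebraic_setOf_eval_le)

/-! ### The cells: unit interval, triangle, coordinate swap -/

/-- The closed unit interval `[0, 1] ⊆ ℝ¹`. -/
def soloInformedUnitI : Set (Fin 1 → ℝ) := {x | 0 ≤ x 0 ∧ x 0 ≤ 1}

/-- The closed standard triangle `{(x, y) | 0 ≤ x, 0 ≤ y, x + y ≤ 1} ⊆ ℝ²`. -/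
def soloInformedTriangle : Set (Fin 2 → ℝ) := {z | 0 ≤ z 0 ∧ 0 ≤ z 1 ∧ z 0 + z 1 ≤ 1}

/-- The coordinate swap `(x, y) ↦ (y, x)` of `ℝ²`. -/
def soloInformedSwap (z : Fin 2 → ℝ) : Fin 2 → ℝ := fun i => z (Equiv.swap (0 : Fin 2) 1 i)

/-- The first coordinate of the swap is the second coordinate. -/
@[simp] theorem soloInformedSwap_apply_zero (z : Fin 2 → ℝ) : soloInformedSwap z 0 = z 1 := by
  simp [soloInformedSwap]

/-- The second coordinate of the swap is the first coordinate. -/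
@[simp] theorem soloInformedSwap_apply_one (z : Fin 2 → ℝ) : soloInformedSwap z 1 = z 0 := by
  simp [soloInformedSwap]

/-- The swap is an involution. -/
@[simp] theorem soloInformedSwap_soloInformedSwap (z : Fin 2 → ℝ) :
    soloInformedSwap (soloInformedSwap z) = z := by
  ext i; fin_cases i <;> simp [soloInformedSwap]

/-- The swap on an explicit vector. -/
theorem soloInformedSwap_vec2 (a b : ℝ) : soloInformedSwap ![a, b] = ![b, a] := by
  ext i; fin_cases i <;> simp [soloInformedSwap]

/-- `swap (x 0, s) = (s, x 0)`. -/
theorem soloInformedSwap_snoc₂ (x : Fin 1 → ℝ) (s : ℝ) :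
    soloInformedSwap (Fin.snoc x s : Fin 2 → ℝ) = ![s, x 0] := by
  have h : (Fin.snoc x s : Fin 2 → ℝ) = ![x 0, s] := by ext i; fin_cases i <;> rfl
  rw [h, soloInformedSwap_vec2]

/-- Membership of an explicit vector in the triangle. -/
theorem soloInformed_vec2_mem_triangle {a b : ℝ} :
    (![a, b] : Fin 2 → ℝ) ∈ soloInformedTriangle ↔ 0 ≤ a ∧ 0 ≤ b ∧ a + b ≤ 1 := by
  simp [soloInformedTriangle]

/-- Membership of a fibre point `(x 0, s)` in the triangle. -/
theorem soloInformed_snoc₂_mem_triangle_iff (x : Fin 1 → ℝ) (s : ℝ) :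
    (Fin.snoc x s : Fin 2 → ℝ) ∈ soloInformedTriangle ↔ 0 ≤ x 0 ∧ 0 ≤ s ∧ x 0 + s ≤ 1 := by
  have h : (Fin.snoc x s : Fin 2 → ℝ) = ![x 0, s] := by ext i; fin_cases i <;> rfl
  rw [h, soloInformed_vec2_mem_triangle]

/-- The triangle is symmetric under the swap. -/
theorem soloInformedSwap_mem_iff {z : Fin 2 → ℝ} :
    soloInformedSwap z ∈ soloInformedTriangle ↔ z ∈ soloInformedTriangle := by
  simp only [soloInformedTriangle, mem_setOf_eq, soloInformedSwap_apply_zero,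
    soloInformedSwap_apply_one]
  constructor <;> rintro ⟨h0, h1, h2⟩ <;> exact ⟨h1, h0, by linarith⟩

/-- The preimage of the triangle under the swap is the triangle (form used by
`IsSemialgebraicFunOn.comp_equiv`). -/
theorem soloInformed_setOf_swap_mem :
    {w : Fin 2 → ℝ | (fun i => w (Equiv.swap (0 : Fin 2) 1 i)) ∈ soloInformedTriangle} =
      soloInformedTriangle := by
  ext w; exact soloInformedSwap_mem_iff

/-- The swap is continuous. -/
theorem continuous_soloInformedSwap : Continuous soloInformedSwap :=
  continuous_pi fun _ => continuous_apply _

/-- The triangle is the band over `[0, 1]` with fibres `[0, 1 − x]` (the domain shape of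
`KZ.newtonLeibnizRel`). -/
theorem soloInformedTriangle_eq_band :
    soloInformedTriangle = {z : Fin 2 → ℝ | Fin.init z ∈ soloInformedUnitI ∧
      (0 : ℝ) ≤ z (Fin.last 1) ∧
      z (Fin.last 1) ≤ 1 - Fin.init z 0} := by
  ext z
  simp only [soloInformedTriangle, soloInformedUnitI, mem_setOf_eq,
    show ∀ z : Fin 2 → ℝ, Fin.init z 0 = z 0 from fun _ => rfl,
    show (Fin.last 1 : Fin 2) = 1 from rfl]
  constructor
  · rintro ⟨h0, h1, h2⟩; exact ⟨⟨h0, by linarith⟩, h1, by linarith⟩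
  · rintro ⟨⟨h0, _⟩, h1, h2⟩; exact ⟨h0, h1, by linarith⟩

/-- `[0, 1]` is `ℚ`-semialgebraic. [BCR 1998, §2.1] -/
theorem isSemialgebraic_soloInformedUnitI : IsSemialgebraic ℚ soloInformedUnitI := by
  have h1 := isSemialgebraic_setOf_eval_le (k := ℚ) (R := ℝ) (0 : MvPolynomial (Fin 1) ℚ)
    (MvPolynomial.X 0)
  have h2 := isSemialgebraic_setOf_eval_le (k := ℚ) (R := ℝ)
    (MvPolynomial.X 0 : MvPolynomial (Fin 1) ℚ) 1
  have h := h1.inter h2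
  simp only [map_zero, map_one, MvPolynomial.aeval_X] at h
  have hset : soloInformedUnitI = {x : Fin 1 → ℝ | 0 ≤ x 0} ∩ {x | x 0 ≤ 1} := by
    ext x; simp [soloInformedUnitI]
  rw [hset]
  exact h

/-- The triangle is `ℚ`-semialgebraic. [BCR 1998, §2.1] -/
theorem isSemialgebraic_soloInformedTriangle : IsSemialgebraic ℚ soloInformedTriangle := by
  have h1 := isSemialgebraic_setOf_eval_le (k := ℚ) (R := ℝ) (0 : MvPolynomial (Fin 2) ℚ)
    (MvPolynomial.X 0)
  have h2 := isSemialgebraic_setOf_eval_le (k := ℚ) (R := ℝ) (0 : MvPolynomial (Fin 2) ℚ)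
    (MvPolynomial.X 1)
  have h3 := isSemialgebraic_setOf_eval_le (k := ℚ) (R := ℝ)
    (MvPolynomial.X 0 + MvPolynomial.X 1 : MvPolynomial (Fin 2) ℚ) 1
  have h := h1.inter (h2.inter h3)
  simp only [map_zero, map_one, map_add, MvPolynomial.aeval_X] at h
  have hset : soloInformedTriangle =
      {z : Fin 2 → ℝ | 0 ≤ z 0} ∩ ({z | 0 ≤ z 1} ∩ {z | z 0 + z 1 ≤ 1}) := by
    ext z; simp [soloInformedTriangle]
  rw [hset]
  exact h

/-- `[0, 1]` is compact. -/
theorem isCompact_soloInformedUnitI : IsCompact soloInformedUnitI := by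
  have : soloInformedUnitI = Icc (0 : Fin 1 → ℝ) 1 := by
    ext x
    simp [soloInformedUnitI, mem_Icc, Pi.le_def, Fin.forall_fin_one]
  rw [this]
  exact isCompact_Icc

/-- The triangle is compact. -/
theorem isCompact_soloInformedTriangle : IsCompact soloInformedTriangle := by
  refine (isCompact_Icc : IsCompact (Icc (0 : Fin 2 → ℝ) 1)).of_isClosed_subset ?_ ?_
  · have : soloInformedTriangle =
        {z : Fin 2 → ℝ | 0 ≤ z 0} ∩ ({z | 0 ≤ z 1} ∩ {z | z 0 + z 1 ≤ 1}) := by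
      ext z; simp [soloInformedTriangle]
    rw [this]
    exact (isClosed_le continuous_const (continuous_apply 0)).inter
      ((isClosed_le continuous_const (continuous_apply 1)).inter
        (isClosed_le ((continuous_apply 0).add (continuous_apply 1)) continuous_const))
  · rintro z ⟨h0, h1, h2⟩
    simp only [mem_Icc, Pi.le_def, Pi.zero_apply, Pi.one_apply, Fin.forall_fin_two]
    exact ⟨⟨h0, h1⟩, by linarith, by linarith⟩

/-! ### Representations over the two cells -/

/-- The representation `[Δ, f]` for a `ℚ`-semialgebraic `f` continuous on the triangle. -/
def soloInformedTriRep (f : (Fin 2 → ℝ) → ℝ) (hs : IsSemialgebraicFunOn ℚ soloInformedTriangle f)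
    (hc : ContinuousOn f soloInformedTriangle) : IntegralRep 2 :=
  ⟨soloInformedTriangle, f, isSemialgebraic_soloInformedTriangle, hs,
    hc.integrableOn_compact isCompact_soloInformedTriangle⟩

/-- The representation `[[0,1], f]` for a `ℚ`-semialgebraic `f` continuous on `[0, 1]`. -/
def soloInformedIRep (f : (Fin 1 → ℝ) → ℝ) (hs : IsSemialgebraicFunOn ℚ soloInformedUnitI f)
    (hc : ContinuousOn f soloInformedUnitI) : IntegralRep 1 :=
  ⟨soloInformedUnitI, f, isSemialgebraic_soloInformedUnitI, hs,
    hc.integrableOn_compact isCompact_soloInformedUnitI⟩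

/-- Domain of `soloInformedTriRep`. -/
@[simp] theorem soloInformedTriRep_domain (f : (Fin 2 → ℝ) → ℝ)
    (hs : IsSemialgebraicFunOn ℚ soloInformedTriangle f)
    (hc : ContinuousOn f soloInformedTriangle) :
    (soloInformedTriRep f hs hc).domain = soloInformedTriangle := rfl

/-- Integrand of `soloInformedTriRep`. -/
@[simp] theorem soloInformedTriRep_integrand (f : (Fin 2 → ℝ) → ℝ)
    (hs : IsSemialgebraicFunOn ℚ soloInformedTriangle f)
    (hc : ContinuousOn f soloInformedTriangle) :
    (soloInformedTriRep f hs hc).integrand = f := rfl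

/-- Domain of `soloInformedIRep`. -/
@[simp] theorem soloInformedIRep_domain (f : (Fin 1 → ℝ) → ℝ)
    (hs : IsSemialgebraicFunOn ℚ soloInformedUnitI f) (hc : ContinuousOn f soloInformedUnitI) :
    (soloInformedIRep f hs hc).domain = soloInformedUnitI := rfl

/-- Integrand of `soloInformedIRep`. -/
@[simp] theorem soloInformedIRep_integrand (f : (Fin 1 → ℝ) → ℝ)
    (hs : IsSemialgebraicFunOn ℚ soloInformedUnitI f)
    (hc : ContinuousOn f soloInformedUnitI) : (soloInformedIRep f hs hc).integrand = f := rfl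

/-! ### Two auxiliary change-of-variables moves with `|det| = 1` -/

/-- A linear involution of `ℝᵏ` has `|det| = 1` (from `det² = det (L ∘ L) = 1`). -/
theorem soloInformed_abs_det_eq_one_of_involutive {k : ℕ} (L : (Fin k → ℝ) →L[ℝ] (Fin k → ℝ))
    (h : ∀ x, L (L x) = x) : |L.det| = 1 := by
  have h2 : (L : (Fin k → ℝ) →ₗ[ℝ] (Fin k → ℝ)) ∘ₗ (L : (Fin k → ℝ) →ₗ[ℝ] (Fin k → ℝ)) =
      LinearMap.id := by
    apply LinearMap.ext
    intro x
    simpa using h x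
  have h3 : L.det * L.det = 1 := by
    have := congrArg LinearMap.det h2
    rwa [LinearMap.det_comp, LinearMap.det_id] at this
  have h4 : |L.det| * |L.det| = 1 := by rw [← abs_mul, h3, abs_one]
  rcases mul_self_eq_one_iff.mp h4 with h5 | h5
  · exact h5
  · linarith [abs_nonneg L.det]

/-- **The coordinate swap of the triangle is a change-of-variables move.** -/
theorem soloInformed_of_sub_of_swap_mem_relations (r r' : IntegralRep 2)
    (hr : r.domain = soloInformedTriangle) (hr' : r'.domain = soloInformedTriangle)
    (h : ∀ z ∈ soloInformedTriangle, r.integrand z = r'.integrand (soloInformedSwap z)) :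
    of r - of r' ∈ relations := by
  set L : (Fin 2 → ℝ) →L[ℝ] (Fin 2 → ℝ) :=
    LinearMap.toContinuousLinearMap (LinearMap.funLeft ℝ ℝ (Equiv.swap (0 : Fin 2) 1)) with hL
  have hLapply : ∀ x, L x = soloInformedSwap x := fun x => by
    rw [hL, LinearMap.coe_toContinuousLinearMap']
    rfl
  have hdet : |L.det| = 1 :=
    soloInformed_abs_det_eq_one_of_involutive L fun x => by
      rw [hLapply, hLapply, soloInformedSwap_soloInformedSwap]
  have himage : L '' soloInformedTriangle = soloInformedTriangle := by
    ext y
    constructor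
    · rintro ⟨x, hx, rfl⟩
      rw [hLapply]
      exact soloInformedSwap_mem_iff.2 hx
    · intro hy
      exact ⟨soloInformedSwap y, soloInformedSwap_mem_iff.2 hy, by
        rw [hLapply, soloInformedSwap_soloInformedSwap]⟩
  have hLsa : IsSemialgebraicMapOn ℚ r.domain L := by
    refine (isSemialgebraicMapOn_aeval r.isSemialgebraic_domain fun j =>
      MvPolynomial.X (Equiv.swap (0 : Fin 2) 1 j)).congr fun x _ => ?_
    rw [hLapply]
    ext j
    simp [soloInformedSwap]
  have hLinj : InjOn L r.domain := fun x _ y _ hxy => by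
    rw [hLapply, hLapply] at hxy
    rw [← soloInformedSwap_soloInformedSwap x, hxy, soloInformedSwap_soloInformedSwap]
  refine changeOfVariablesRel_subset_relations ⟨2, r, r', L, fun _ => L, hLsa,
    fun _ _ => L.hasFDerivWithinAt, hLinj, by rw [hr', hr, himage], fun x hx => ?_, rfl⟩
  show r.integrand x = r'.integrand (L x) * |L.det|
  rw [hdet, mul_one, hLapply]
  exact h x (hr ▸ hx)

/-- **The reflection `t ↦ 1 − t` of `[0, 1]` is a change-of-variables move.** -/
theorem soloInformed_of_sub_of_reflect_mem_relations (r r' : IntegralRep 1)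
    (hr : r.domain = soloInformedUnitI) (hr' : r'.domain = soloInformedUnitI)
    (h : ∀ x ∈ soloInformedUnitI, r.integrand x = r'.integrand (fun _ => 1 - x 0)) :
    of r - of r' ∈ relations := by
  set L : (Fin 1 → ℝ) →L[ℝ] (Fin 1 → ℝ) := -ContinuousLinearMap.id ℝ (Fin 1 → ℝ) with hL
  set p : Fin 1 → ℝ := fun _ => 1 with hp
  set Φ : (Fin 1 → ℝ) → (Fin 1 → ℝ) := fun x => p + L x with hΦ
  have hΦapply : ∀ x, Φ x = fun _ => 1 - x 0 := fun x => by
    ext i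
    fin_cases i
    simp [hΦ, hp, hL, sub_eq_add_neg]
  have hΦΦ : ∀ x, Φ (Φ x) = x := fun x => by
    rw [hΦapply, hΦapply]
    ext i
    fin_cases i
    simp
  have hdet : |L.det| = 1 := soloInformed_abs_det_eq_one_of_involutive L fun x => by simp [hL]
  have hmem : ∀ x ∈ soloInformedUnitI, Φ x ∈ soloInformedUnitI := fun x hx => by
    rw [hΦapply]
    have hx' : 0 ≤ x 0 ∧ x 0 ≤ 1 := hx
    show 0 ≤ 1 - x 0 ∧ 1 - x 0 ≤ 1
    constructor <;> linarith [hx'.1, hx'.2]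
  have himage : Φ '' soloInformedUnitI = soloInformedUnitI := by
    ext y
    constructor
    · rintro ⟨x, hx, rfl⟩; exact hmem x hx
    · intro hy; exact ⟨Φ y, hmem y hy, hΦΦ y⟩
  have hΦsa : IsSemialgebraicMapOn ℚ r.domain Φ := by
    refine (isSemialgebraicMapOn_aeval r.isSemialgebraic_domain fun _ =>
      (1 - MvPolynomial.X 0 : MvPolynomial (Fin 1) ℚ)).congr fun x _ => ?_
    rw [hΦapply]
    ext j
    simp
  have hinj : InjOn Φ r.domain := fun x _ y _ hxy => by rw [← hΦΦ x, hxy, hΦΦ]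
  refine changeOfVariablesRel_subset_relations ⟨1, r, r', Φ, fun _ => L, hΦsa,
    fun x _ => (L.hasFDerivAt.const_add p).hasFDerivWithinAt, hinj, by rw [hr', hr, himage],
    fun x hx => ?_, rfl⟩
  show r.integrand x = r'.integrand (Φ x) * |L.det|
  rw [hdet, mul_one, hΦapply]
  exact h x (hr ▸ hx)

/-! ### Calculus along the fibres -/

/-- The vertical fibre `s ↦ (x 0, s)` has velocity `e₁`. -/
theorem soloInformed_hasDerivAt_snoc₂ (x : Fin 1 → ℝ) (t : ℝ) :
    HasDerivAt (fun s : ℝ => (Fin.snoc x s : Fin 2 → ℝ)) (Pi.single 1 1) t := by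
  refine hasDerivAt_pi.2 fun i => ?_
  fin_cases i
  · simpa [show ∀ s : ℝ, (Fin.snoc x s : Fin 2 → ℝ) 0 = x 0 from fun _ => rfl] using
      hasDerivAt_const t (x 0)
  · simpa [show ∀ s : ℝ, (Fin.snoc x s : Fin 2 → ℝ) 1 = s from fun _ => rfl] using
      hasDerivAt_id' t

/-- The horizontal fibre `s ↦ (s, x 0)` has velocity `e₀`. -/
theorem soloInformed_hasDerivAt_swap_snoc₂ (x : Fin 1 → ℝ) (t : ℝ) :
    HasDerivAt (fun s : ℝ => soloInformedSwap (Fin.snoc x s : Fin 2 → ℝ)) (Pi.single 0 1) t := by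
  refine hasDerivAt_pi.2 fun i => ?_
  fin_cases i
  · simpa [show ∀ s : ℝ, (Fin.snoc x s : Fin 2 → ℝ) 1 = s from fun _ => rfl] using
      hasDerivAt_id' t
  · simpa [show ∀ s : ℝ, (Fin.snoc x s : Fin 2 → ℝ) 0 = x 0 from fun _ => rfl] using
      hasDerivAt_const t (x 0)

/-- The vertical fibre map is continuous. -/
theorem soloInformed_continuous_snoc₂ (x : Fin 1 → ℝ) :
    Continuous fun s : ℝ => (Fin.snoc x s : Fin 2 → ℝ) :=
  continuous_iff_continuousAt.2 fun t => (soloInformed_hasDerivAt_snoc₂ x t).continuousAt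

/-- Edge maps: a polynomial map `[0,1] → Δ` composed with a semialgebraic continuous function. -/
theorem soloInformed_edge_comp {W : Set (Fin 2 → ℝ)} (hTW : soloInformedTriangle ⊆ W)
    {g : (Fin 2 → ℝ) → ℝ}
    (hgs : IsSemialgebraicFunOn ℚ W g) (hgc : ContinuousOn g W)
    (P : Fin 2 → MvPolynomial (Fin 1) ℚ) (e : (Fin 1 → ℝ) → Fin 2 → ℝ)
    (he : ∀ x, (fun j => MvPolynomial.aeval x (P j)) = e x)
    (hm : MapsTo e soloInformedUnitI soloInformedTriangle) :
    IsSemialgebraicFunOn ℚ soloInformedUnitI (fun x => g (e x)) ∧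
      ContinuousOn (fun x => g (e x)) soloInformedUnitI := by
  have hes : IsSemialgebraicMapOn ℚ soloInformedUnitI e :=
    (isSemialgebraicMapOn_aeval isSemialgebraic_soloInformedUnitI P).congr fun x _ => he x
  have hec : Continuous e := by
    have : e = fun x j => MvPolynomial.aeval x (P j) := funext fun x => (he x).symm
    rw [this]
    refine continuous_pi fun j => ?_
    simpa only [MvPolynomial.aeval_def, MvPolynomial.eval_map] using
      MvPolynomial.continuous_eval (MvPolynomial.map (algebraMap ℚ ℝ) (P j))
  exact ⟨IsSemialgebraicFunOn.comp_isSemialgebraicMapOn_holds hgs hes (hm.mono_right hTW),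
    hgc.comp hec.continuousOn (hm.mono_right hTW)⟩

end Summit.KontsevichZagierPeriods.KontsevichZagierPeriods.Theorems
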